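import Literature.MathematicalPhysics.QuantumLattice.GrassmannKernelExpansion
import HarnessLib

/-!
# The kernels are totally antisymmetric: `kernel F m (X ∘ σ) = sign σ · kernel F m X`; pinned weighted `L¹` sums do not depend on the leg positions

Topic `MathematicalPhysics/QuantumLattice`; continuation of `GrassmannKernelExpansion` (`eq_sum_presented_kernel`: `F = Σ_m presented (kernel F m)`) and
`GrassmannKernelsPresented` (`kernel_presented`: the kernel of a presented polynomial is the antisymmetrisation of its presentation).  Salmhofer 1998,
(3.12) / Salmhofer 1999, (4.95): the coefficient functions `F_m` are totally antisymmetric.  Consequences used by the two-volume pass of the engine of the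
cell gate-hubbard-kl (the first-moment data of a kernel may be supplied at ANY pair of leg positions):

* **`kernel_comp_perm`** — `kernel F m (X ∘ σ) = sign σ · kernel F m X`; `norm_kernel_comp_perm` — the norms agree;
* **`sum_pinned_weight_norm_kernel_comp_perm`** — `Σ_{X : X p = w} φ (X j) ‖kernel F (m+1) X‖ = Σ_{Z : Z (σ⁻¹ p) = w} φ (Z (σ⁻¹ j)) ‖kernel F (m+1) Z‖`: a weighted
  pinned sum is unchanged when the pinned position and the weighted position are moved together by a permutation.

Everything is proved; no definition, no named fact.

## Sources
M. Salmhofer, Commun. Math. Phys. 194 (1998) 249–295, §3.2 (3.12) [`Salmhofer1998`]; M. Salmhofer, *Renormalization: An Introduction* (Springer 1999), §4.3 (4.95)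
[`Salmhofer1999`]; F. A. Berezin, *The Method of Second Quantization* (1966), Ch. I §3 [`Berezin1966`].
-/

noncomputable section

namespace Literature.MathematicalPhysics.QuantumLattice

open GrassmannAlgebra Finset

section Antisymmetry

variable (R : Type*) [CommRing R] [Algebra ℚ R] {Γ : Type*} [Fintype Γ] [DecidableEq Γ]

/-- Antisymmetry of an antisymmetrisation: the kernel of a presented polynomial. [cite: Salmhofer1999, §4.3 (4.95)] -/
theorem kernel_presented_comp_perm {m : ℕ} (φ : (Fin m → Γ) → R) (X : Fin m → Γ) (σ : Equiv.Perm (Fin m)) :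
    kernel R (presented R φ) m (X ∘ σ) = ((Equiv.Perm.sign σ : ℤ) : R) * kernel R (presented R φ) m X := by
  have hsq : ((Equiv.Perm.sign σ : ℤ) : R) * ((Equiv.Perm.sign σ : ℤ) : R) = 1 := by
    rw [← Int.cast_mul, ← Units.val_mul, Int.units_mul_self, Units.val_one, Int.cast_one]
  -- the term-by-term identity under the reindexing `τ ↦ σ * τ`
  have hterm : ∀ τ : Equiv.Perm (Fin m), Equiv.Perm.sign τ • φ ((X ∘ ⇑σ) ∘ ⇑τ) =
      ((Equiv.Perm.sign σ : ℤ) : R) * (Equiv.Perm.sign (σ * τ) • φ (X ∘ ⇑(σ * τ))) := by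
    intro τ
    rw [Units.smul_def, Units.smul_def, zsmul_eq_mul, zsmul_eq_mul, map_mul, Units.val_mul, Int.cast_mul, ← mul_assoc,
      ← mul_assoc, hsq, one_mul]
    rfl
  have key : ∑ τ : Equiv.Perm (Fin m), Equiv.Perm.sign τ • φ ((X ∘ ⇑σ) ∘ ⇑τ) =
      ((Equiv.Perm.sign σ : ℤ) : R) * ∑ τ : Equiv.Perm (Fin m), Equiv.Perm.sign τ • φ (X ∘ ⇑τ) := by
    rw [Finset.mul_sum]
    exact Fintype.sum_equiv (Equiv.mulLeft σ) _ (fun τ' => ((Equiv.Perm.sign σ : ℤ) : R) * (Equiv.Perm.sign τ' • φ (X ∘ ⇑τ')))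
      (fun τ => hterm τ)
  rw [kernel_presented, kernel_presented, key]
  ring

/-- **Total antisymmetry of the kernels**: `kernel F m (X ∘ σ) = sign σ · kernel F m X`. [cite: Salmhofer1999, §4.3 (4.95)] -/
theorem kernel_comp_perm (F : GrassmannAlgebra R Γ) (m : ℕ) (X : Fin m → Γ) (σ : Equiv.Perm (Fin m)) :
    kernel R F m (X ∘ σ) = ((Equiv.Perm.sign σ : ℤ) : R) * kernel R F m X := by
  have hF : ∀ Y : Fin m → Γ, kernel R F m Y = ∑ k ∈ range (Fintype.card Γ + 1), kernel R (presented R (kernel R F k)) m Y := by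
    intro Y
    conv_lhs => rw [eq_sum_presented_kernel R F]
    rw [kernel_sum]
  rw [hF, hF, Finset.mul_sum]
  refine Finset.sum_congr rfl fun k _ => ?_
  by_cases hk : m = k
  · subst hk; exact kernel_presented_comp_perm R _ X σ
  · rw [kernel_presented_of_ne R _ _ hk, kernel_presented_of_ne R _ _ hk, mul_zero]

end Antisymmetry

section Norms

variable {𝕜 : Type*} [RCLike 𝕜] {Γ : Type*} [Fintype Γ] [DecidableEq Γ]

/-- The norm of a kernel is invariant under permutations of its arguments. [cite: Salmhofer1998, §3.2 (3.12)] -/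
theorem norm_kernel_comp_perm (F : GrassmannAlgebra 𝕜 Γ) (m : ℕ) (X : Fin m → Γ) (σ : Equiv.Perm (Fin m)) :
    ‖kernel 𝕜 F m (X ∘ σ)‖ = ‖kernel 𝕜 F m X‖ := by
  rw [kernel_comp_perm 𝕜 F m X σ, norm_mul]
  rcases Int.units_eq_one_or (Equiv.Perm.sign σ) with h | h <;> simp [h]

/-- **Weighted pinned sums do not depend on the leg positions**: moving the pinned position `p` and the weighted position `j` together by a permutation
`σ` leaves `Σ_{X : X p = w} φ (X j) ‖kernel F (m+1) X‖` unchanged (`X ↦ X ∘ σ`, antisymmetry).  So the first-moment data of a kernel may be supplied at any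
pair of positions. [cite: Salmhofer1998, §4.1] -/
theorem sum_pinned_weight_norm_kernel_comp_perm (F : GrassmannAlgebra 𝕜 Γ) {m : ℕ} (φ : Γ → ℝ) (σ : Equiv.Perm (Fin (m + 1)))
    (p j : Fin (m + 1)) (w : Γ) :
    ∑ X ∈ univ.filter (fun X : Fin (m + 1) → Γ => X p = w), φ (X j) * ‖kernel 𝕜 F (m + 1) X‖ =
      ∑ Z ∈ univ.filter (fun Z : Fin (m + 1) → Γ => Z (σ p) = w), φ (Z (σ j)) * ‖kernel 𝕜 F (m + 1) Z‖ := by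
  -- substitute `X = Z ∘ σ`, i.e. `Z = X ∘ σ⁻¹`
  refine sum_nbij' (fun X => X ∘ ⇑σ.symm) (fun Z => Z ∘ ⇑σ) ?_ ?_ ?_ ?_ ?_
  · intro X hX
    refine mem_filter.2 ⟨mem_univ _, ?_⟩
    simpa using (mem_filter.1 hX).2
  · intro Z hZ
    refine mem_filter.2 ⟨mem_univ _, ?_⟩
    simpa using (mem_filter.1 hZ).2
  · intro X _; funext i; simp
  · intro Z _; funext i; simp
  · intro X _
    have h := norm_kernel_comp_perm F (m + 1) (X ∘ ⇑σ.symm) σ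
    have hc : (X ∘ ⇑σ.symm) ∘ ⇑σ = X := by funext i; simp
    rw [hc] at h
    simp only [Function.comp_apply, Equiv.symm_apply_apply]
    rw [h]

end Norms


end Literature.MathematicalPhysics.QuantumLattice

end
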